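import Summits.KontsevichZagierPeriods.KontsevichZagierPeriods.Theses.IsogenyCertificates
import Summits.KontsevichZagierPeriods.KontsevichZagierPeriods.Theorems.EffectiveXMapChains.Negative.CountedTransfer
import Summits.KontsevichZagierPeriods.KontsevichZagierPeriods.Theorems.EffectiveXMapChains.Negative.PeriodRep
import Summits.KontsevichZagierPeriods.KontsevichZagierPeriods.Theorems.IsogenyCertificatesXMapPeriodTransferCellsBasic
import Literature.NumberTheory.Transcendental.KZRelationsLE

/-!
# `EffectiveXMapChains` (stmt-KontsevichZagierPeriods-10664, route IsogenyCertificates) — line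
`full-component-sheets`, stub `stub_closing`

The closing step of the line. Let `P(w) = w³ + Aw + B` be nonsingular and let
`U = {x | ∀ w ≥ x, P(w) > 0}` be the unbounded component of `{P > 0}` (an up-closed ray containing
`[1 + |A| + |B|, ∞)`), lifted to `ℝ¹ = Fin 1 → ℝ`. The line has reduced both sides of the crux to
stacks `m • [U, s/√P]` and `n • [U, t/√P]` of Kontsevich–Zagier integral representations with equal
values. This file proves that `m • [U, s/√P] − n • [U, t/√P]` is then a chain of at most `m + n + 2`
signed moves of the calculus inside dimension `1` (`KZ.ChainLE 1 (m + n + 2)`):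

* MERGING (`Closing.chainLE_nsmul_sub`): `k` copies of a representation `[σ, f]` merge into one
  representation `[σ, k·f]` by `k + 1` integrand-additivity moves (rule (1b); the zero-integrand
  representation `[σ, 0·f]` is itself minus one move, `0 = 0 + 0`);
* VALUES: `[U, q/√P]` has value `q · Ω_U`, `Ω_U = ∫_U dx/√P > 0` (the integrand is positive on `U`
  and `U ⊇ [1 + |A| + |B|, ∞)` has infinite Lebesgue measure), so equality of the values of the two
  stacks pins `m·s = n·t`, whence `[U, (m s)/√P] = [U, (n t)/√P]` and the two merging chains
  concatenate.

No definitions are introduced; the representations `[U, q/√P]` are the restrictions to `U` of the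
period representations `periodRep A B q` of `Negative/PeriodRep.lean`.

References: M. Kontsevich, D. Zagier, *Periods* (2001), §1.2 rule (1); J. E. Cremona, *Algorithms
for Modular Elliptic Curves* (1997), §3.7 (the real period integral).
-/

noncomputable section

open Polynomial Set MeasureTheory
open Literature.NumberTheory.Transcendental Literature.ModelTheory.ExponentialFields
open Summit.KontsevichZagierPeriods.IsogenyCertificates.EffectiveXMapChainsNegative
open Summit.KontsevichZagierPeriods.IsogenyCertificates.XMapPeriodTransferCells
  (cubic_pos_of_large_le)

namespace Summit.KontsevichZagierPeriods.IsogenyCertificates.EffectiveXMapChainsLine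

namespace Closing

/-- **Merging by integrand additivity.** If `ρ k` (`k : ℕ`) are representations on the domain of
`base` with integrands `k · (base.integrand)` on that domain, then `k • [base] − [ρ k]` is a chain
of at most `k + 1` moves of rule (1b) inside the dimension of `base`: `[ρ 0]` has zero integrand,
so `−[ρ 0]` is the instance `0 = 0 + 0`, and `[ρ (k+1)] − [ρ k] − [base]` is the instance
`(k+1)·f = k·f + f`. [cite: KontsevichZagier2001, §1.2 rule (1)] -/
theorem chainLE_nsmul_sub {n : ℕ} (base : KZ.IntegralRep n) (ρ : ℕ → KZ.IntegralRep n)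
    (hd : ∀ k, (ρ k).domain = base.domain)
    (hi : ∀ k, ∀ x ∈ base.domain, (ρ k).integrand x = (k : ℝ) * base.integrand x) (k : ℕ) :
    KZ.ChainLE n (k + 1) (k • KZ.of base - KZ.of (ρ k)) := by
  induction k with
  | zero =>
    have h0 : EqOn (ρ 0).integrand 0 (ρ 0).domain := fun x hx => by
      rw [hd 0] at hx
      simpa using hi 0 x hx
    have hmv : -KZ.of (ρ 0) ∈ KZ.movesLE n :=
      ⟨neg_of_mem_moves_of_integrand_zero h0, neg_mem (KZ.of_mem_formalRepLE (ρ 0) le_rfl)⟩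
    simpa using KZ.ChainLE.of_mem_movesLE hmv
  | succ k ih =>
    have hmv : KZ.of (ρ (k + 1)) - KZ.of (ρ k) - KZ.of base ∈ KZ.movesLE n := by
      refine ⟨Or.inl (Or.inl (Or.inr ⟨n, ρ (k + 1), ρ k, base, (hd k).trans (hd (k + 1)).symm,
        (hd (k + 1)).symm, fun x hx => ?_, rfl⟩)), ?_⟩
      · rw [hd] at hx
        simp only [Pi.add_apply, hi (k + 1) x hx, hi k x hx, Nat.cast_succ]
        ring
      · exact sub_mem (sub_mem (KZ.of_mem_formalRepLE _ le_rfl) (KZ.of_mem_formalRepLE _ le_rfl))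
          (KZ.of_mem_formalRepLE _ le_rfl)
    have h := ih.sub (KZ.ChainLE.of_mem_movesLE hmv)
    have e : k • KZ.of base - KZ.of (ρ k) - (KZ.of (ρ (k + 1)) - KZ.of (ρ k) - KZ.of base) =
        (k + 1) • KZ.of base - KZ.of (ρ (k + 1)) := by
      rw [succ_nsmul]
      abel
    rw [e] at h
    exact h

/-- The lifted ray `{y : ℝ¹ | M ≤ y 0}` has infinite Lebesgue measure (transport of
`volume (Ici M) = ∞` along `ℝ¹ ≃ᵐ ℝ`). [folklore] -/
theorem volume_lift_Ici (M : ℝ) : volume {y : Fin 1 → ℝ | M ≤ y 0} = ⊤ := by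
  have h := (volume_preserving_funUnique (Fin 1) ℝ).measure_preimage_equiv (Ici M)
  rw [Real.volume_Ici] at h
  exact h

end Closing

/-- **Stub (closing).** For nonsingular `P = X³ + AX + B`, `U` the unbounded component of `{P > 0}`
lifted to `ℝ¹`, and representations `u = [U, s/√P]`, `v = [U, t/√P]`: if `m • [u]` and `n • [v]`
have the same value then `m • [u] − n • [v]` is a chain of at most `m + n + 2` signed moves inside
dimension `1`. Merge `m • [u]` into `[U, (m s)/√P]` and `n • [v]` into `[U, (n t)/√P]` by integrand
additivity (`m + 1` and `n + 1` moves), and observe `m s = n t` since the values are `m s Ω_U`,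
`n t Ω_U` with `Ω_U = ∫_U dx/√P > 0`. [cite: KontsevichZagier2001, §1.2 rule (1)] -/
theorem stub_closing (A B : ℤ) (hΔ : 4 * A ^ 3 + 27 * B ^ 2 ≠ 0) (s t : ℚ) (hs : 0 < s) (ht : 0 < t) (u v : KZ.IntegralRep 1) (hud : u.domain = {y : Fin 1 → ℝ | y 0 ∈ {x : ℝ | ∀ w : ℝ, x ≤ w → 0 < w ^ 3 + (A : ℝ) * w + (B : ℝ)}}) (hui : u.integrand = fun y => (s : ℝ) / Real.sqrt (y 0 ^ 3 + (A : ℝ) * y 0 + (B : ℝ))) (hvd : v.domain = {y : Fin 1 → ℝ | y 0 ∈ {x : ℝ | ∀ w : ℝ, x ≤ w → 0 < w ^ 3 + (A : ℝ) * w + (B : ℝ)}}) (hvi : v.integrand = fun y => (t : ℝ) / Real.sqrt (y 0 ^ 3 + (A : ℝ) * y 0 + (B : ℝ))) (m n : ℕ) (hval : KZ.eval (m • KZ.of u) = KZ.eval (n • KZ.of v)) : KZ.ChainLE 1 (m + n + 2) (m • KZ.of u - n • KZ.of v) := by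
  -- positivity of the scalars is not needed (the period `Ω_U > 0` does the cancelling)
  have _ := hs
  have _ := ht
  -- the common domain `U = lift unb ⊆ {P > 0}`
  have hvu : v.domain = u.domain := hvd.trans hud.symm
  have hUsub : u.domain ⊆ {x : Fin 1 → ℝ | 0 < x 0 ^ 3 + (A : ℝ) * x 0 + (B : ℝ)} := by
    rw [hud]
    exact fun y hy => hy (y 0) le_rfl
  -- the representations `[U, q/√P]`, `q : ℚ`
  set w : ℚ → KZ.IntegralRep 1 := fun q =>
    (periodRep A B q hΔ).restrict u.domain u.isSemialgebraic_domain hUsub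
  have hwi : ∀ (q : ℚ) (y : Fin 1 → ℝ),
      (w q).integrand y = (q : ℝ) / Real.sqrt (y 0 ^ 3 + (A : ℝ) * y 0 + (B : ℝ)) :=
    fun q y => rfl
  -- merging: `m • [u] − [U, (m s)/√P]` and `n • [v] − [U, (n t)/√P]`
  have hmu : KZ.ChainLE 1 (m + 1) (m • KZ.of u - KZ.of (w (m * s))) := by
    refine Closing.chainLE_nsmul_sub u (fun k => w (k * s)) (fun _ => rfl) (fun k y _ => ?_) m
    rw [hwi, hui]
    push_cast
    ring
  have hnv : KZ.ChainLE 1 (n + 1) (n • KZ.of v - KZ.of (w (n * t))) := by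
    refine Closing.chainLE_nsmul_sub v (fun k => w (k * t)) (fun _ => hvu.symm) (fun k y _ => ?_) n
    rw [hwi, hvi]
    push_cast
    ring
  -- values: `u.value = s Ω`, `v.value = t Ω`, `Ω = ∫_U dx/√P`
  obtain ⟨Ω, hΩ⟩ : ∃ Ω : ℝ,
      Ω = ∫ y in u.domain, 1 / Real.sqrt (y 0 ^ 3 + (A : ℝ) * y 0 + (B : ℝ)) := ⟨_, rfl⟩
  have hint : ∀ c : ℝ,
      ∫ y in u.domain, c / Real.sqrt (y 0 ^ 3 + (A : ℝ) * y 0 + (B : ℝ)) = c * Ω := by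
    intro c
    rw [hΩ, ← integral_const_mul]
    congr 1
    funext y
    rw [mul_one_div]
  have huval : u.value = (s : ℝ) * Ω := by
    unfold KZ.IntegralRep.value
    rw [hui]
    exact hint s
  have hvval : v.value = (t : ℝ) * Ω := by
    unfold KZ.IntegralRep.value
    rw [hvi, hvu]
    exact hint t
  -- `Ω > 0`: the integrand is positive on `U`, and `U ⊇ lift [1 + |A| + |B|, ∞)` is not null
  have hΩpos : 0 < Ω := by
    have hfi : IntegrableOn
        (fun y : Fin 1 → ℝ => 1 / Real.sqrt (y 0 ^ 3 + (A : ℝ) * y 0 + (B : ℝ))) u.domain :=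
      (integrableOn_rep hΔ 1).mono_set hUsub
    rw [hΩ, setIntegral_pos_iff_support_of_nonneg_ae (Filter.Eventually.of_forall fun y => ?_) hfi]
    · have hsub : {y : Fin 1 → ℝ | 1 + |(A : ℝ)| + |(B : ℝ)| ≤ y 0} ⊆
          (Function.support fun y : Fin 1 → ℝ =>
            1 / Real.sqrt (y 0 ^ 3 + (A : ℝ) * y 0 + (B : ℝ))) ∩ u.domain := by
        intro y hy
        have hyU : ∀ w' : ℝ, y 0 ≤ w' → 0 < w' ^ 3 + (A : ℝ) * w' + (B : ℝ) :=
          fun w' hw' => cubic_pos_of_large_le A B (le_trans hy hw')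
        refine ⟨?_, ?_⟩
        · rw [Function.mem_support]
          exact (one_div_pos.mpr (Real.sqrt_pos.mpr (hyU (y 0) le_rfl))).ne'
        · rw [hud]
          exact hyU
      refine lt_of_lt_of_le ?_ (measure_mono hsub)
      rw [Closing.volume_lift_Ici]
      exact ENNReal.zero_lt_top
    · simp only [Pi.zero_apply]
      positivity
  -- the scalar relation `m s = n t`
  have hrat : (m : ℚ) * s = (n : ℚ) * t := by
    rw [map_nsmul, map_nsmul, KZ.eval_of, KZ.eval_of, huval, hvval, nsmul_eq_mul, nsmul_eq_mul,
      ← mul_assoc, ← mul_assoc] at hval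
    have h := mul_right_cancel₀ hΩpos.ne' hval
    exact_mod_cast h
  -- assemble
  have hfin := hmu.sub hnv
  rw [hrat] at hfin
  have e : m • KZ.of u - KZ.of (w (n * t)) - (n • KZ.of v - KZ.of (w (n * t))) =
      m • KZ.of u - n • KZ.of v := by
    abel
  rw [e] at hfin
  exact hfin.mono le_rfl (by omega)

end Summit.KontsevichZagierPeriods.IsogenyCertificates.EffectiveXMapChainsLine
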